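import Mathlib
import HarnessLib
import Summits.ValiantsHypothesis.ValiantsHypothesis.Theorems.LacunarySymmetroidMatrixDescartesProductPlusOneTameSector

/-!
# ValiantsHypothesis / LacunarySymmetroid — crux `MatrixDescartes` (stmt-ValiantsHypothesis-18050, V1),
# LINE (A) «product_plus_one», `stub_classRowK3`: the `x ↦ 1/x` REVERSAL of the class and the tame sector with TOP coupling

`card_pos_roots_class_reverse_le` / `card_pos_roots_class_reverse`: for any `D` dominating the support, the member with support
`l ↦ D − d l` (same coefficient rows, same coupled letter, same `c`) has the same number of positive zeros as the member with support
`d` — the class is closed under `x ↦ 1/x` (`t ↦ t⁻¹` on the positive zeros; `eval t M_{D−d} = t^{mD} · eval t⁻¹ M_d`).  Hence the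
bottom-coupling tame sector (`tame_sector_class`, ratio `(d₂−d₀)/(d₁−d₀) ≤ 4`) gives the TOP-coupling tame sector
`tame_sector_class_top`: `d 0 < d 1 < d 2`, `d 2 − d 0 ≤ 4·(d 2 − d 1)`, `a j 0 · a j 2 < 0` ⇒
`Z₊(C c X^{m·d 2} + ∏_j Σ_l C (a j l) X^{d l}) ≤ 2m + 2`.

HONEST FRAMING: bookkeeping + a second sector of the `K = 3` row; NOT `stub_classRowK3`, not `stub_polyLaw`, not `ProductPlusOneMDR`,
not `MatrixDescartes`, not Conjecture B; `VP ≠ VNP` is NOT proved.  No definitions, no named facts; Mathlib + the lane files.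
-/

-- `Summit.ValiantsHypothesis.ValiantsHypothesis.…` is the tree's mandated single-conjunct layout (Sub = Summit).
set_option linter.dupNamespace false

namespace Summit.ValiantsHypothesis.ValiantsHypothesis.Theorems.LacunarySymmetroidMatrixDescartes

namespace ProductPlusOne

open Polynomial Finset
open scoped BigOperators

/-- Evaluation of a member. [folklore] -/
theorem eval_member {m K : ℕ} (d : Fin K → ℕ) (a : Fin m → Fin K → ℝ) (N : ℕ) (c : ℝ) (t : ℝ) :
    eval t (C c * X ^ N + ∏ j, ∑ l, C (a j l) * X ^ (d l) : ℝ[X]) = c * t ^ N + ∏ j, ∑ l, a j l * t ^ (d l) := by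
  simp only [eval_add, eval_mul, eval_C, eval_pow, eval_X, eval_prod, eval_finsetSum]

/-- **Reversal identity**: for `t ≠ 0` and `D` dominating the support,
`eval t (member with support D − d) = t^{mD} · eval t⁻¹ (member with support d)`. [folklore] -/
theorem eval_member_reverse {m K : ℕ} (d : Fin K → ℕ) (D : ℕ) (hD : ∀ l, d l ≤ D) (a : Fin m → Fin K → ℝ)
    (l₀ : Fin K) (c : ℝ) {t : ℝ} (ht : t ≠ 0) :
    eval t (C c * X ^ (m * (D - d l₀)) + ∏ j, ∑ l, C (a j l) * X ^ (D - d l) : ℝ[X])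
      = t ^ (m * D) * eval t⁻¹ (C c * X ^ (m * d l₀) + ∏ j, ∑ l, C (a j l) * X ^ (d l) : ℝ[X]) := by
  rw [eval_member, eval_member, mul_add]
  have hpow : ∀ n : ℕ, n ≤ D → t ^ (D - n) = t ^ D * t⁻¹ ^ n := by
    intro n hn
    rw [inv_pow, ← div_eq_mul_inv, eq_div_iff (pow_ne_zero _ ht), ← pow_add, Nat.sub_add_cancel hn]
  congr 1
  · rw [Nat.mul_sub, ← mul_assoc, mul_comm (t ^ (m * D)) c, mul_assoc]
    congr 1
    rw [inv_pow, ← div_eq_mul_inv, eq_div_iff (pow_ne_zero _ ht), ← pow_add,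
      Nat.sub_add_cancel (Nat.mul_le_mul_left m (hD l₀))]
  · have hc : (t ^ D) ^ m = ∏ _j : Fin m, t ^ D := by
      rw [Finset.prod_const, Finset.card_univ, Fintype.card_fin]
    rw [pow_mul', hc, ← Finset.prod_mul_distrib]
    refine Finset.prod_congr rfl (fun j _ => ?_)
    rw [Finset.mul_sum]
    refine Finset.sum_congr rfl (fun l _ => ?_)
    rw [hpow (d l) (hD l)]
    ring

/-- Positive zeros of the reversed member inject into positive zeros of the member (`t ↦ t⁻¹`). [folklore] -/
theorem card_pos_roots_class_reverse_le {m K : ℕ} (d : Fin K → ℕ) (D : ℕ) (hD : ∀ l, d l ≤ D) (a : Fin m → Fin K → ℝ)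
    (l₀ : Fin K) (c : ℝ) :
    ((C c * X ^ (m * (D - d l₀)) + ∏ j, ∑ l, C (a j l) * X ^ (D - d l) : ℝ[X]).roots.toFinset.filter (fun t => 0 < t)).card
      ≤ ((C c * X ^ (m * d l₀) + ∏ j, ∑ l, C (a j l) * X ^ (d l) : ℝ[X]).roots.toFinset.filter (fun t => 0 < t)).card := by
  classical
  by_cases hM : (C c * X ^ (m * d l₀) + ∏ j, ∑ l, C (a j l) * X ^ (d l) : ℝ[X]) = 0
  · -- then the reversed member vanishes on `(0,∞)`, hence is `0` too
    have hM' : (C c * X ^ (m * (D - d l₀)) + ∏ j, ∑ l, C (a j l) * X ^ (D - d l) : ℝ[X]) = 0 := by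
      apply Polynomial.eq_zero_of_infinite_isRoot
      apply Set.infinite_of_injective_forall_mem (f := fun n : ℕ => (n : ℝ) + 1)
      · intro x y hxy
        exact_mod_cast (add_left_injective 1 hxy : (x : ℝ) = y)
      · intro n
        have hpos : (0 : ℝ) < n + 1 := by positivity
        show IsRoot _ _
        rw [IsRoot.def, eval_member_reverse d D hD a l₀ c hpos.ne', hM, eval_zero, mul_zero]
    rw [hM', hM]
  refine Finset.card_le_card_of_injOn (fun t => t⁻¹) (fun t ht => ?_) (fun x hx y hy hxy => inv_injective hxy)
  rw [mem_coe, mem_filter, Multiset.mem_toFinset] at ht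
  have ht0 : 0 < t := ht.2
  have hM'0 : (C c * X ^ (m * (D - d l₀)) + ∏ j, ∑ l, C (a j l) * X ^ (D - d l) : ℝ[X]) ≠ 0 := by
    intro h
    rw [h, roots_zero] at ht
    exact Multiset.notMem_zero _ ht.1
  have hroot := (mem_roots hM'0).mp ht.1
  rw [IsRoot.def, eval_member_reverse d D hD a l₀ c ht0.ne'] at hroot
  rw [mem_coe, mem_filter, Multiset.mem_toFinset, mem_roots hM, IsRoot.def]
  refine ⟨?_, inv_pos.mpr ht0⟩
  rcases mul_eq_zero.mp hroot with h | h
  · exact absurd h (pow_ne_zero _ ht0.ne')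
  · exact h

/-- **The class is closed under `x ↦ 1/x`**: equal numbers of positive zeros for the supports `d` and `D − d`. [folklore] -/
theorem card_pos_roots_class_reverse {m K : ℕ} (d : Fin K → ℕ) (D : ℕ) (hD : ∀ l, d l ≤ D) (a : Fin m → Fin K → ℝ)
    (l₀ : Fin K) (c : ℝ) :
    ((C c * X ^ (m * (D - d l₀)) + ∏ j, ∑ l, C (a j l) * X ^ (D - d l) : ℝ[X]).roots.toFinset.filter (fun t => 0 < t)).card
      = ((C c * X ^ (m * d l₀) + ∏ j, ∑ l, C (a j l) * X ^ (d l) : ℝ[X]).roots.toFinset.filter (fun t => 0 < t)).card := by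
  refine le_antisymm (card_pos_roots_class_reverse_le d D hD a l₀ c) ?_
  have h := card_pos_roots_class_reverse_le (fun l => D - d l) D (fun l => Nat.sub_le D (d l)) a l₀ c
  have hdd : ∀ l, D - (D - d l) = d l := fun l => Nat.sub_sub_self (hD l)
  simp only [hdd] at h
  exact h

/-- **THE TAME SECTOR WITH TOP COUPLING**: `d 0 < d 1 < d 2`, `d 2 − d 0 ≤ 4·(d 2 − d 1)`, `a j 0 · a j 2 < 0` ⇒ the member coupled
at the TOP exponent `m · d 2` has at most `2m + 2` positive zeros. [this file's theorem] -/
theorem tame_sector_class_top {m : ℕ} (d : Fin 3 → ℕ) (h01 : d 0 < d 1) (h12 : d 1 < d 2)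
    (h4 : d 2 - d 0 ≤ 4 * (d 2 - d 1)) (a : Fin m → Fin 3 → ℝ) (hac : ∀ j, a j 0 * a j 2 < 0) (c : ℝ) :
    ((C c * X ^ (m * d 2) + ∏ j, ∑ l, C (a j l) * X ^ (d l) : ℝ[X]).roots.toFinset.filter (fun t => 0 < t)).card
      ≤ 2 * m + 2 := by
  -- reverse with `D = d 2`: support `d' l = d 2 − d l`, coupled exponent `d' 2 = 0`; reindex `l ↦ 2 − l`
  have hD : ∀ l : Fin 3, d l ≤ d 2 := by
    intro l
    fin_cases l <;> simp <;> omega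
  have hrev := card_pos_roots_class_reverse d (d 2) hD a 2 c
  rw [← hrev, Nat.sub_self, mul_zero]
  -- the reversed member, reindexed, is a bottom-coupled member on the increasing support (0, d2−d1, d2−d0)
  have hre : (C c * X ^ 0 + ∏ j, ∑ l, C (a j l) * X ^ (d 2 - d l) : ℝ[X])
      = C c * X ^ (m * (![0, d 2 - d 1, d 2 - d 0] : Fin 3 → ℕ) 0)
        + ∏ j, ∑ l, C ((fun j l => a j (2 - l)) j l) * X ^ ((![0, d 2 - d 1, d 2 - d 0] : Fin 3 → ℕ) l) := by
    simp only [Matrix.cons_val_zero, mul_zero]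
    congr 1
    refine Finset.prod_congr rfl (fun j _ => ?_)
    simp only [Fin.sum_univ_three, Matrix.cons_val_zero, Matrix.cons_val_one, Matrix.head_cons, Matrix.cons_val_two,
      Matrix.tail_cons, Nat.sub_self]
    have e1 : (2 : Fin 3) - 0 = 2 := rfl
    have e2 : (2 : Fin 3) - 1 = 1 := rfl
    have e3 : (2 : Fin 3) - 2 = 0 := rfl
    rw [e1, e2, e3]
    ring
  rw [hre]
  refine tame_sector_class (![0, d 2 - d 1, d 2 - d 0]) ?_ ?_ ?_ (fun j l => a j (2 - l)) ?_ c
  · simp; omega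
  · simp; omega
  · simp; omega
  · intro j
    have e1 : (2 : Fin 3) - 0 = 2 := rfl
    have e3 : (2 : Fin 3) - 2 = 0 := rfl
    simp only [e1, e3]
    rw [mul_comm]
    exact hac j

end ProductPlusOne

end Summit.ValiantsHypothesis.ValiantsHypothesis.Theorems.LacunarySymmetroidMatrixDescartes
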